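import Literature.Algebra.EuclideanLattices.DualGridQuality
import HarnessLib

/-!
# Serving an integer lattice `L(U)` through the `DualGrid` stack: `B_U = invMatrix Uᵀ`, `Λ' = det(U)^{4n−4} · L(U)`

Topic `Algebra/EuclideanLattices` (family `pqc`). The attempt of MR07 Thm. 5.9 formalised in the
`DualGrid*` files runs on the lattice `Λ = G ℤⁿ` attached to a PRIMAL matrix `B`
(`G = GSInverse.invMatrix B`, `B G = Dg I`). An `IncGDD` solver in the wire format of
`MRLemma510Function.lean` receives instead the ROWS `U` of a basis of an integer lattice `L(U)`. This file
is the adapter: feeding the stack with `B_U := invMatrix Uᵀ` makes its lattice a SCALED copy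
`Λ' = c_U · L(U)`, `c_U = det(U)^{4n−4}`, on which an `IncGDD` instance `(L(U), S, t, r)` becomes
`(Λ', c S, c t, c r)` with the same answers. Proved:

* `invMatrix_invMatrix` — `invMatrix (invMatrix T) = det(T)^{4n−4} • T`; hence `det_BU_ne_zero`,
  `G_BU` (`G B_U = c_U • Uᵀ`), `cU_pos`;
* `mem_dualLat_BU_iff` — `x ∈ Λ' ⇔ c_U⁻¹ x ∈ L(U)`; `smul_vecMul_mem_dualLat_BU` (`c (z U) ∈ Λ'`);
  `smoothingParameter_dualLat_BU` (`η_ε(Λ') = c_U η_ε(L(U))`);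
* `answerOf U u'` — the coefficient row `z = (u' · invMatrix U)/(c_U det(U)²)` of an answer `u' ∈ Λ'`,
  with `answerOf_eq` (`u' = c (z U) ⇒ answerOf U u' = z`) and `exists_answerOf` (every `u' ∈ Λ'` is
  `c (z U)` with `z = answerOf U u'`).

## References

* D. Micciancio, O. Regev, *Worst-case to average-case reductions based on Gaussian measures*,
  SIAM J. Comput. 37 (2007) 267–302; authors' version, Def. 5.6 (`IncGDD`), Thm. 5.9, Cor. 5.13.
* H. Cohen, *A Course in Computational Algebraic Number Theory*, Springer 1993, §2.6.3 [Cohen1993].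
-/

noncomputable section

open scoped Classical

namespace Literature.Algebra.EuclideanLattices

open Module Submodule Matrix Finset GSInverse

namespace DualGrid

variable {n : ℕ}

/-! ### `invMatrix ∘ invMatrix` -/

/-- Cancelling a nonsingular integer matrix on the left. [folklore] -/
theorem eq_of_mul_eq_mul_left {T X Y : Matrix (Fin n) (Fin n) ℤ} (hT : T.det ≠ 0) (h : T * X = T * Y) : X = Y := by
  have h2 : T.adjugate * (T * X) = T.adjugate * (T * Y) := by rw [h]
  rw [← Matrix.mul_assoc, ← Matrix.mul_assoc, Matrix.adjugate_mul, Matrix.smul_mul, Matrix.smul_mul, Matrix.one_mul,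
    Matrix.one_mul] at h2
  exact (smul_right_injective _ hT) h2

/-- `det (invMatrix T) · det T = det(T)^{2n}`. [cite: Cohen1993, §2.6.3] -/
theorem det_invMatrix_mul_det {T : Matrix (Fin n) (Fin n) ℤ} (hT : T.det ≠ 0) : T.det * (invMatrix T).det = T.det ^ (2 * n) := by
  have h := congrArg Matrix.det (mul_invMatrix hT)
  rwa [Matrix.det_mul, Matrix.det_smul, Matrix.det_one, mul_one, Fintype.card_fin, ← pow_mul] at h

/-- `det (invMatrix T) ≠ 0`. [folklore] -/
theorem det_invMatrix_ne_zero {T : Matrix (Fin n) (Fin n) ℤ} (hT : T.det ≠ 0) : (invMatrix T).det ≠ 0 := fun h => by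
  have := det_invMatrix_mul_det hT
  rw [h, mul_zero] at this
  exact pow_ne_zero _ hT this.symm

/-- **`invMatrix (invMatrix T) = det(T)^{4n−4} • T`.** [cite: Cohen1993, §2.6.3] -/
theorem invMatrix_invMatrix {T : Matrix (Fin n) (Fin n) ℤ} (hT : T.det ≠ 0) :
    invMatrix (invMatrix T) = T.det ^ (4 * n - 4) • T := by
  rcases Nat.eq_zero_or_pos n with rfl | hn
  · ext i j; exact i.elim0
  set W := invMatrix T with hW
  have hW0 : W.det ≠ 0 := det_invMatrix_ne_zero hT
  have hWT : W * T = (T.det ^ 2) • (1 : Matrix (Fin n) (Fin n) ℤ) := mul_eq_smul_one_comm (pow_ne_zero 2 hT) (mul_invMatrix hT)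
  -- `det W = det(T)^{2n-1}`
  have hdetW : W.det = T.det ^ (2 * n - 1) := by
    have h := det_invMatrix_mul_det hT
    rw [← hW] at h
    have h2 : T.det * W.det = T.det * T.det ^ (2 * n - 1) := by
      rw [h, ← pow_succ', Nat.sub_add_cancel (by omega)]
    exact mul_left_cancel₀ hT h2
  refine eq_of_mul_eq_mul_left hW0 ?_
  rw [mul_invMatrix hW0, Matrix.mul_smul, hWT, smul_smul, hdetW, ← pow_mul, ← pow_add]
  congr 2
  omega

/-! ### The adapter -/

/-- **The primal matrix for the solver**: `B_U = invMatrix Uᵀ`. [folklore] -/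
def BU (U : Matrix (Fin n) (Fin n) ℤ) : Matrix (Fin n) (Fin n) ℤ := invMatrix U.transpose

/-- **The scaling factor `c_U = det(U)^{4n−4}`.** [folklore] -/
def cU (U : Matrix (Fin n) (Fin n) ℤ) : ℤ := U.det ^ (4 * n - 4)

/-- `det B_U ≠ 0`. [folklore] -/
theorem det_BU_ne_zero {U : Matrix (Fin n) (Fin n) ℤ} (hU : U.det ≠ 0) : (BU U).det ≠ 0 :=
  det_invMatrix_ne_zero (by rwa [Matrix.det_transpose])

/-- `c_U > 0` (an even power). [folklore] -/
theorem cU_pos {U : Matrix (Fin n) (Fin n) ℤ} (hU : U.det ≠ 0) : 0 < cU U := by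
  rw [cU, show 4 * n - 4 = 2 * (2 * n - 2) by omega, pow_mul]
  exact pow_pos (by positivity) _

/-- **`G B_U = c_U • Uᵀ`**: the columns of `G` are `c_U` times the rows of `U`. [cite: Cohen1993, §2.6.3] -/
theorem G_BU {U : Matrix (Fin n) (Fin n) ℤ} (hU : U.det ≠ 0) : G (BU U) = cU U • U.transpose := by
  rw [G, BU, invMatrix_invMatrix (by rwa [Matrix.det_transpose]), Matrix.det_transpose, cU]

/-- `G B_U z = c_U (z U)` (columns of `G` against `z` = `c_U` times the row combination). [folklore] -/
theorem G_BU_mulVec {U : Matrix (Fin n) (Fin n) ℤ} (hU : U.det ≠ 0) (z : Fin n → ℤ) :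
    G (BU U) *ᵥ z = cU U • (z ᵥ* U) := by
  rw [G_BU hU, Matrix.smul_mulVec, Matrix.mulVec_transpose]

/-- **`Λ' = c_U · L(U)`**: `x ∈ dualLat B_U ⇔ c_U⁻¹ x ∈ L(U)`. [folklore] -/
theorem mem_dualLat_BU_iff {U : Matrix (Fin n) (Fin n) ℤ} (hU : U.det ≠ 0) (x : EuclideanSpace ℝ (Fin n)) :
    x ∈ dualLat (BU U) ↔ ((cU U : ℝ))⁻¹ • x ∈ (⟨n, U⟩ : LatticeInstance).lattice := by
  have hc : (cU U : ℝ) ≠ 0 := by exact_mod_cast (cU_pos hU).ne'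
  rw [mem_dualLat_iff, LatticeInstance.mem_lattice_iff]
  constructor
  · rintro ⟨z, rfl⟩
    refine ⟨z, ?_⟩
    rw [G_BU_mulVec hU]
    change intVecToEuclidean n (Matrix.vecMul z U) = (cU U : ℝ)⁻¹ • intVecToEuclidean n (cU U • Matrix.vecMul z U)
    rw [map_zsmul, ← Int.cast_smul_eq_zsmul ℝ, smul_smul, inv_mul_cancel₀ hc, one_smul]
  · rintro ⟨z, hz⟩
    refine ⟨z, ?_⟩
    change intVecToEuclidean n (Matrix.vecMul z U) = (cU U : ℝ)⁻¹ • x at hz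
    rw [G_BU_mulVec hU, map_zsmul, ← Int.cast_smul_eq_zsmul ℝ, hz, smul_smul, mul_inv_cancel₀ hc, one_smul]

/-- **Scaled lattice rows lie in `Λ'`**: `c_U • (z U) ∈ dualLat B_U`. [folklore] -/
theorem smul_vecMul_mem_dualLat_BU {U : Matrix (Fin n) (Fin n) ℤ} (hU : U.det ≠ 0) (z : Fin n → ℤ) :
    intVecToEuclidean n (cU U • (z ᵥ* U)) ∈ dualLat (BU U) := by
  rw [← G_BU_mulVec hU]; exact G_mulVec_mem_dualLat _ _

/-- **`η_ε(Λ') = c_U · η_ε(L(U))`.** [cite: MicciancioRegev2007, Def. 3.1 (homogeneity)] -/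
theorem smoothingParameter_dualLat_BU {U : Matrix (Fin n) (Fin n) ℤ} (hU : U.det ≠ 0) (ε : ℝ) :
    smoothingParameter (dualLat (BU U)) ε = (cU U : ℝ) * smoothingParameter ((⟨n, U⟩ : LatticeInstance).lattice) ε :=
  smoothingParameter_eq_mul_of_scaled (by exact_mod_cast cU_pos hU) (mem_dualLat_BU_iff hU) ε

/-! ### Converting an answer of `Λ'` into coefficients of the rows of `U` -/

/-- **The coefficient row of an answer**: `z = (u' · invMatrix U)/(c_U det(U)²)`. [cite: Cohen1993, §2.6.3] -/
def answerOf (U : Matrix (Fin n) (Fin n) ℤ) (u' : Fin n → ℤ) : Fin n → ℤ :=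
  fun i => (u' ᵥ* invMatrix U) i / (cU U * U.det ^ 2)

/-- `(z U) · invMatrix U = det(U)² z`. [cite: Cohen1993, §2.6.3] -/
theorem vecMul_vecMul_invMatrix {U : Matrix (Fin n) (Fin n) ℤ} (hU : U.det ≠ 0) (z : Fin n → ℤ) :
    (z ᵥ* U) ᵥ* invMatrix U = (U.det ^ 2) • z := by
  rw [Matrix.vecMul_vecMul, mul_invMatrix hU, Matrix.vecMul_smul, Matrix.vecMul_one]

/-- **The conversion is correct**: if `u' = c_U (z U)` then `answerOf U u' = z`. [folklore] -/
theorem answerOf_eq {U : Matrix (Fin n) (Fin n) ℤ} (hU : U.det ≠ 0) {u' z : Fin n → ℤ} (h : u' = cU U • (z ᵥ* U)) :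
    answerOf U u' = z := by
  have hcd : cU U * U.det ^ 2 ≠ 0 := mul_ne_zero (cU_pos hU).ne' (pow_ne_zero 2 hU)
  funext i
  rw [answerOf, h, Matrix.smul_vecMul, vecMul_vecMul_invMatrix hU, smul_smul, Pi.smul_apply, smul_eq_mul,
    Int.mul_ediv_cancel_left _ hcd]

/-- **Every answer in `Λ'` converts**: `u' ∈ dualLat B_U` is `c_U (z U)` for `z = answerOf U u'`. [folklore] -/
theorem exists_answerOf {U : Matrix (Fin n) (Fin n) ℤ} (hU : U.det ≠ 0) {u' : Fin n → ℤ}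
    (hu : intVecToEuclidean n u' ∈ dualLat (BU U)) : u' = cU U • (answerOf U u' ᵥ* U) := by
  obtain ⟨z, hz⟩ := (mem_dualLat_iff (BU U) _).1 hu
  rw [G_BU_mulVec hU] at hz
  have hu' : u' = cU U • (z ᵥ* U) := (intVecToEuclidean_injective n hz).symm
  rw [answerOf_eq hU hu', ← hu']

/-- The converted answer in `ℝⁿ`: `(answerOf U u') U = c_U⁻¹ u'`. [folklore] -/
theorem cast_answerOf_vecMul {U : Matrix (Fin n) (Fin n) ℤ} (hU : U.det ≠ 0) {u' : Fin n → ℤ}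
    (hu : intVecToEuclidean n u' ∈ dualLat (BU U)) :
    intVecToEuclidean n (answerOf U u' ᵥ* U) = ((cU U : ℝ))⁻¹ • intVecToEuclidean n u' := by
  have hc : (cU U : ℝ) ≠ 0 := by exact_mod_cast (cU_pos hU).ne'
  conv_rhs => rw [exists_answerOf hU hu]
  rw [map_zsmul, ← Int.cast_smul_eq_zsmul ℝ, smul_smul, inv_mul_cancel₀ hc, one_smul]

end DualGrid

end Literature.Algebra.EuclideanLattices

end
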